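import Summits.AtomisticToContinuum.Crystallization.Theorems.DisclinationRationBarlowLiouvilleTrivialPrice

/-!
# `BarlowLiouville` (route `DisclinationRation`), stubs `stub_cellsToPatches` / `stub_rigidityCompactness`,
# part 1: cells and patches under translation, local limits and fine local matches

Support file (part 1 of 3) for item stmt-AtomisticToContinuum-15801 (crux
`Summit.AtomisticToContinuum.Crystallization.Theses.DisclinationRation.BarlowLiouville`, line
`Sketch`, rev 4 of the lead skeleton `DisclinationRationBarlowLiouville`), registered stubs
`stub_cellsToPatches` / `stub_rigidityCompactness` (CELLS TO PATCHES: `ς`-good `2`-cells on a large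
ball force an `η`-good `R`-patch). Vocabulary of the line, always INLINED (no definitions):
`CELL ς X y` = "the `2`-cell `X − y` is two-way `ς`-matched on the OPEN ball `‖·‖ < 2` with a rigid
image `{A (i u(a) + j v(a) + L_s(m) w(a) + z(m) e₃)}` of a relaxed layered set (`a ∈ [47/50, 1]`, Hägg
word `s`, heights `z` with increments in `[39a/50, 17a/20]`)", `PATCH R η X y` = the same on the closed
ball `‖·‖ ≤ R` with tolerance `η`. This part proves the four model-independent facts consumed by the
contradiction-and-compactness argument of the final part `…StubCellsToPatches`:

* `rc_cell_translate`, `rc_patch_translate` — cells and patches are translation-covariant;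
* `rc_cell_limit` — if `δ`-separated sets `Xs k`, locally matched (eventually, at every radius and
  tolerance) with a `δ`-separated `Y`, have `ςs k`-good cells on `‖·‖ ≤ r + 1` with `ςs k → 0`, then every
  point of `Y` of norm `≤ r` has `ς`-good cells for EVERY `ς > 0` (borrow the data of the cell of a nearby
  point of a far-out `Xs k`; the OPEN ball and the gap `rc_gap` below radius `2` left by the finitely many
  points of `Y ∩ B̄_2(w)` give the margin needed to transport the second matching clause);
* `rc_patch_transfer` — a good patch of `Y` at `0` transports back along a fine local match;
* `rc_zero_mem`, `rc_gap` — two facts about `δ`-separated sets.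

No definitions; Mathlib + `LocalMatchingCompactness` (`BallMatch`,
`finite_of_forall_le_dist_of_subset_closedBall`) only. [folklore] throughout.
-/

noncomputable section

namespace Summit.AtomisticToContinuum.Crystallization.Theorems.DisclinationRationBarlowLiouville

open Filter Topology Metric
open Literature.MathematicalPhysics.StatisticalMechanics Literature.Geometry.DiscreteGeometry
-- `E3 = EuclideanSpace ℝ (Fin 3)` as the (reducible) library abbreviation (no notation declared here).
open Summit.AtomisticToContinuum.Crystallization.Theorems.ChargedEnergyGapNegative (E3)

/-! ## Two facts about `δ`-separated sets -/

/-- If every `Xs k` contains `0` and the `Xs k` are locally matched, for every tolerance, eventually,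
with a `δ`-separated `Y`, then `0 ∈ Y`. [folklore] -/
theorem rc_zero_mem {δ : ℝ} (hδ : 0 < δ) {Xs : ℕ → Set E3} {Y : Set E3}
    (hYsep : ∀ p ∈ Y, ∀ q ∈ Y, p ≠ q → δ ≤ dist p q) (h0 : ∀ k, (0 : E3) ∈ Xs k)
    (hBM : ∀ R ε : ℝ, 0 < ε → ∀ᶠ k in atTop, BallMatch ε R 0 (Xs k) Y) : (0 : E3) ∈ Y := by
  have hnear : ∀ ε : ℝ, 0 < ε → ∃ s ∈ Y, ‖s‖ ≤ ε := fun ε hε => by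
    obtain ⟨k, hk⟩ := (hBM 0 ε hε).exists
    obtain ⟨s, hs, hd⟩ := hk.2 0 (h0 k) (dist_self (0 : E3)).le
    exact ⟨s, hs, by rwa [dist_comm, dist_zero_right] at hd⟩
  by_contra h0Y
  obtain ⟨s₁, hs₁, hs₁n⟩ := hnear (δ / 4) (by positivity)
  have hpos : 0 < ‖s₁‖ := norm_pos_iff.2 fun h => h0Y (h ▸ hs₁)
  obtain ⟨s₂, hs₂, hs₂n⟩ := hnear (min (δ / 4) (‖s₁‖ / 2)) (by positivity)
  have h₂δ := hs₂n.trans (min_le_left _ _)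
  have h₂s := hs₂n.trans (min_le_right _ _)
  have hne : s₁ ≠ s₂ := fun h => by
    rw [← h] at h₂s
    linarith
  have h := hYsep s₁ hs₁ s₂ hs₂ hne
  linarith [dist_le_norm_add_norm s₁ s₂]

/-- A `δ`-separated `Y` leaves a gap below radius `2` about any centre `w`: for some `γ > 0` no point
`q ∈ Y` has `2 - γ ≤ ‖q - w‖ < 2` (finitely many points of `Y` in `B̄_2(w)`). [folklore] -/
theorem rc_gap {δ : ℝ} (hδ : 0 < δ) {Y : Set E3}
    (hYsep : ∀ p ∈ Y, ∀ q ∈ Y, p ≠ q → δ ≤ dist p q) (w : E3) :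
    ∃ γ : ℝ, 0 < γ ∧ ∀ q ∈ Y, ‖q - w‖ < 2 → ‖q - w‖ + γ < 2 := by
  have hfin : (Y ∩ closedBall w 2).Finite :=
    finite_of_forall_le_dist_of_subset_closedBall hδ
      (fun p hp q hq hpq => hYsep p hp.1 q hq.1 hpq) Set.inter_subset_right
  have hev : ∀ᶠ γ in 𝓝[>] (0 : ℝ), ∀ q ∈ Y ∩ closedBall w 2, ‖q - w‖ < 2 → ‖q - w‖ + γ < 2 := by
    refine hfin.eventually_all.2 fun q _ => ?_
    by_cases hq2 : ‖q - w‖ < 2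
    · have ht : Tendsto (fun γ : ℝ => ‖q - w‖ + γ) (𝓝[>] 0) (𝓝 (‖q - w‖ + 0)) :=
        tendsto_nhdsWithin_of_tendsto_nhds ((continuous_const_add _).tendsto 0)
      rw [add_zero] at ht
      exact (ht.eventually_lt_const hq2).mono fun γ h _ => h
    · exact Eventually.of_forall fun γ h => absurd h hq2
  obtain ⟨γ, hγ, hγ0⟩ := (hev.and self_mem_nhdsWithin).exists
  exact ⟨γ, hγ0, fun q hq hq2 =>
    hγ q ⟨hq, mem_closedBall.2 (by rw [dist_eq_norm]; exact hq2.le)⟩ hq2⟩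

/-! ## Cells and patches under translation -/

/-- CELLS ARE TRANSLATION-COVARIANT: the `ς`-cell of `X` at `y'` is the `ς`-cell of `X - y` at
`y' - y` (both are stated through differences of points). [folklore] -/
theorem rc_cell_translate : ∀ (ς : ℝ) (X : Set E3) (y y' : E3),
    (∃ a : ℝ, 47 / 50 ≤ a ∧ a ≤ 1 ∧
      ∃ (A : E3 →ₗᵢ[ℝ] E3) (s : ℤ → ℤ) (z : ℤ → ℝ), IsHaggSeq s ∧
        (∀ m : ℤ, 39 / 50 * a ≤ z (m + 1) - z m ∧ z (m + 1) - z m ≤ 17 / 20 * a) ∧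
        let S : Set E3 := {p | ∃ m i j : ℤ, p = A (((i : ℝ) • triangularVec₁ a) +
          ((j : ℝ) • triangularVec₂ a) + ((haggLabel s m : ℝ) • barlowOffset a) +
          (z m • layerNormal 1))}
        (∀ p ∈ S, ‖p‖ < 2 → ∃ q ∈ X, dist (q - y') p ≤ ς) ∧
        (∀ q ∈ X, ‖q - y'‖ < 2 → ∃ p ∈ S, dist (q - y') p ≤ ς)) →
    (∃ a : ℝ, 47 / 50 ≤ a ∧ a ≤ 1 ∧
      ∃ (A : E3 →ₗᵢ[ℝ] E3) (s : ℤ → ℤ) (z : ℤ → ℝ), IsHaggSeq s ∧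
        (∀ m : ℤ, 39 / 50 * a ≤ z (m + 1) - z m ∧ z (m + 1) - z m ≤ 17 / 20 * a) ∧
        let S : Set E3 := {p | ∃ m i j : ℤ, p = A (((i : ℝ) • triangularVec₁ a) +
          ((j : ℝ) • triangularVec₂ a) + ((haggLabel s m : ℝ) • barlowOffset a) +
          (z m • layerNormal 1))}
        (∀ p ∈ S, ‖p‖ < 2 → ∃ q ∈ (fun q => q - y) '' X, dist (q - (y' - y)) p ≤ ς) ∧
        (∀ q ∈ (fun q => q - y) '' X, ‖q - (y' - y)‖ < 2 →
          ∃ p ∈ S, dist (q - (y' - y)) p ≤ ς)) := by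
  intro ς X y y' h
  obtain ⟨a, ha, ha1, A, s, z, hs, hz, h12⟩ := h
  dsimp only at h12
  obtain ⟨h1, h2⟩ := h12
  refine ⟨a, ha, ha1, A, s, z, hs, hz, ?_⟩
  dsimp only
  refine ⟨fun p hp hp2 => ?_, fun x hx hx2 => ?_⟩
  · obtain ⟨q, hq, hd⟩ := h1 p hp hp2
    exact ⟨q - y, ⟨q, hq, rfl⟩, by rwa [sub_sub_sub_cancel_right]⟩
  · obtain ⟨q, hq, rfl⟩ := (Set.mem_image _ _ _).1 hx
    rw [sub_sub_sub_cancel_right] at hx2 ⊢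
    exact h2 q hq hx2

/-- PATCHES ARE TRANSLATION-COVARIANT: an `(R, η)`-patch of `X - y` at `0` is an `(R, η)`-patch of `X`
at `y`. [folklore] -/
theorem rc_patch_translate : ∀ (R η : ℝ) (X : Set E3) (y : E3),
    (∃ a : ℝ, 47 / 50 ≤ a ∧ a ≤ 1 ∧
      ∃ (A : E3 →ₗᵢ[ℝ] E3) (s : ℤ → ℤ) (z : ℤ → ℝ), IsHaggSeq s ∧
        (∀ m : ℤ, 39 / 50 * a ≤ z (m + 1) - z m ∧ z (m + 1) - z m ≤ 17 / 20 * a) ∧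
        let S : Set E3 := {p | ∃ m i j : ℤ, p = A (((i : ℝ) • triangularVec₁ a) +
          ((j : ℝ) • triangularVec₂ a) + ((haggLabel s m : ℝ) • barlowOffset a) +
          (z m • layerNormal 1))}
        (∀ p ∈ S, ‖p‖ ≤ R → ∃ q ∈ (fun q => q - y) '' X, dist (q - 0) p ≤ η) ∧
        (∀ q ∈ (fun q => q - y) '' X, ‖q - 0‖ ≤ R → ∃ p ∈ S, dist (q - 0) p ≤ η)) →
    (∃ a : ℝ, 47 / 50 ≤ a ∧ a ≤ 1 ∧
      ∃ (A : E3 →ₗᵢ[ℝ] E3) (s : ℤ → ℤ) (z : ℤ → ℝ), IsHaggSeq s ∧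
        (∀ m : ℤ, 39 / 50 * a ≤ z (m + 1) - z m ∧ z (m + 1) - z m ≤ 17 / 20 * a) ∧
        let S : Set E3 := {p | ∃ m i j : ℤ, p = A (((i : ℝ) • triangularVec₁ a) +
          ((j : ℝ) • triangularVec₂ a) + ((haggLabel s m : ℝ) • barlowOffset a) +
          (z m • layerNormal 1))}
        (∀ p ∈ S, ‖p‖ ≤ R → ∃ q ∈ X, dist (q - y) p ≤ η) ∧
        (∀ q ∈ X, ‖q - y‖ ≤ R → ∃ p ∈ S, dist (q - y) p ≤ η)) := by
  intro R η X y h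
  obtain ⟨a, ha, ha1, A, s, z, hs, hz, h12⟩ := h
  dsimp only at h12
  obtain ⟨h1, h2⟩ := h12
  refine ⟨a, ha, ha1, A, s, z, hs, hz, ?_⟩
  dsimp only
  refine ⟨fun p hp hpR => ?_, fun q hq hqR => ?_⟩
  · obtain ⟨x, hx, hd⟩ := h1 p hp hpR
    obtain ⟨q, hq, rfl⟩ := (Set.mem_image _ _ _).1 hx
    exact ⟨q, hq, by rwa [sub_zero] at hd⟩
  · obtain ⟨p, hp, hd⟩ := h2 (q - y) ⟨q, hq, rfl⟩ (by rwa [sub_zero])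
    exact ⟨p, hp, by rwa [sub_zero] at hd⟩

/-! ## Passing cells to a local limit, and patches back -/

/-- EXACT CELLS IN THE LIMIT. Let `Y` be `δ`-separated and locally matched, at every radius and
tolerance, eventually, by sets `Xs k` all of whose points of norm `≤ r + 1` have (eventually) `ςs k`-good
cells, `ςs k → 0`. Then every `w ∈ Y` of norm `≤ r` has `ς`-good cells for EVERY `ς > 0`: take the data of the
cell of a partner `w_k` of `w` in a far-out `Xs k`; a layered point `p`, `‖p‖ < 2`, has an `Xs k`-partner
near `w_k + p`, which has a `Y`-partner; a point `q ∈ Y` with `‖q - w‖ < 2` has an `Xs k`-partner `q_k`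
with `‖q_k - w_k‖ < 2` STILL (the gap `rc_gap` below radius `2`), which has a layered partner. [folklore] -/
theorem rc_cell_limit : ∀ δ : ℝ, 0 < δ → ∀ (Xs : ℕ → Set E3) (Y : Set E3) (ςs : ℕ → ℝ) (r : ℝ),
    (∀ p ∈ Y, ∀ q ∈ Y, p ≠ q → δ ≤ dist p q) →
    (∀ R ε : ℝ, 0 < ε → ∀ᶠ k in atTop, BallMatch ε R 0 (Xs k) Y) →
    Tendsto ςs atTop (𝓝 0) →
    (∀ᶠ k : ℕ in atTop, ∀ w' ∈ Xs k, ‖w'‖ ≤ r + 1 → (∃ a : ℝ, 47 / 50 ≤ a ∧ a ≤ 1 ∧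
      ∃ (A : E3 →ₗᵢ[ℝ] E3) (s : ℤ → ℤ) (z : ℤ → ℝ), IsHaggSeq s ∧
        (∀ m : ℤ, 39 / 50 * a ≤ z (m + 1) - z m ∧ z (m + 1) - z m ≤ 17 / 20 * a) ∧
        let S : Set E3 := {p | ∃ m i j : ℤ, p = A (((i : ℝ) • triangularVec₁ a) +
          ((j : ℝ) • triangularVec₂ a) + ((haggLabel s m : ℝ) • barlowOffset a) +
          (z m • layerNormal 1))}
        (∀ p ∈ S, ‖p‖ < 2 → ∃ q ∈ Xs k, dist (q - w') p ≤ ςs k) ∧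
        (∀ q ∈ Xs k, ‖q - w'‖ < 2 → ∃ p ∈ S, dist (q - w') p ≤ ςs k))) →
    ∀ w ∈ Y, dist w 0 ≤ r → ∀ ς : ℝ, 0 < ς → (∃ a : ℝ, 47 / 50 ≤ a ∧ a ≤ 1 ∧
      ∃ (A : E3 →ₗᵢ[ℝ] E3) (s : ℤ → ℤ) (z : ℤ → ℝ), IsHaggSeq s ∧
        (∀ m : ℤ, 39 / 50 * a ≤ z (m + 1) - z m ∧ z (m + 1) - z m ≤ 17 / 20 * a) ∧
        let S : Set E3 := {p | ∃ m i j : ℤ, p = A (((i : ℝ) • triangularVec₁ a) +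
          ((j : ℝ) • triangularVec₂ a) + ((haggLabel s m : ℝ) • barlowOffset a) +
          (z m • layerNormal 1))}
        (∀ p ∈ S, ‖p‖ < 2 → ∃ q ∈ Y, dist (q - w) p ≤ ς) ∧
        (∀ q ∈ Y, ‖q - w‖ < 2 → ∃ p ∈ S, dist (q - w) p ≤ ς)) := by
  intro δ hδ Xs Y ςs r hYsep hBM hT hcell w hw hwr ς hς
  rw [dist_zero_right] at hwr
  obtain ⟨γ, hγ0, hγ⟩ := rc_gap hδ hYsep w
  -- the tolerance of the approximation
  obtain ⟨ε, hε0, hες, hεγ, hε1⟩ : ∃ ε : ℝ, 0 < ε ∧ 3 * ε ≤ ς ∧ 2 * ε ≤ γ ∧ ε ≤ 1 :=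
    ⟨min (ς / 3) (min (γ / 2) 1), by positivity,
      by linarith [min_le_left (ς / 3) (min (γ / 2) 1)],
      by linarith [min_le_right (ς / 3) (min (γ / 2) 1), min_le_left (γ / 2) 1],
      (min_le_right _ _).trans (min_le_right _ _)⟩
  -- one index far out, and the partner `wk` of `w` there
  obtain ⟨k, hBMk, hςk, hcellk⟩ :=
    ((hBM (r + 4) ε hε0).and ((hT.eventually (eventually_le_nhds hε0)).and hcell)).exists
  obtain ⟨wk, hwk, hwkw⟩ := hBMk.1 w hw (by rw [dist_zero_right]; linarith)
  have hwkn : ‖wk‖ ≤ r + 1 := by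
    have h3 := dist_triangle wk w 0
    rw [dist_zero_right, dist_zero_right] at h3
    linarith
  -- borrow the data of the cell of `wk`
  obtain ⟨a, ha, ha1, A, s, z, hs, hz, h12⟩ := hcellk wk hwk hwkn
  dsimp only at h12
  obtain ⟨h1, h2⟩ := h12
  refine ⟨a, ha, ha1, A, s, z, hs, hz, ?_⟩
  dsimp only
  refine ⟨fun p hp hp2 => ?_, fun q hq hq2 => ?_⟩
  · obtain ⟨qk, hqk, hd⟩ := h1 p hp hp2
    have hqkn : dist qk 0 ≤ r + 4 := by
      rw [dist_zero_right]
      have h3 : ‖qk - wk - p‖ ≤ ςs k := by rwa [← dist_eq_norm]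
      have h4 := norm_add₃_le (a := qk - wk - p) (b := p) (c := wk)
      rw [sub_add_cancel, sub_add_cancel] at h4
      linarith
    obtain ⟨q, hqY, hqd⟩ := hBMk.2 qk hqk hqkn
    refine ⟨q, hqY, ?_⟩
    calc dist (q - w) p ≤ dist (q - w) (qk - wk) + dist (qk - wk) p := dist_triangle _ _ _
      _ ≤ (dist q qk + dist w wk) + ςs k := add_le_add (dist_sub_sub_le _ _ _ _) hd
      _ ≤ ς := by rw [dist_comm q qk, dist_comm w wk]; linarith
  · have hqn : dist q 0 ≤ r + 4 := by
      rw [dist_zero_right]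
      have h3 := norm_add_le (q - w) w
      rw [sub_add_cancel] at h3
      linarith
    obtain ⟨qk, hqk, hqd⟩ := hBMk.1 q hq hqn
    have hlt : ‖qk - wk‖ < 2 := by
      have h3 : dist (qk - wk) (q - w) ≤ dist qk q + dist wk w := dist_sub_sub_le _ _ _ _
      rw [dist_eq_norm] at h3
      have h4 := norm_add_le (qk - wk - (q - w)) (q - w)
      rw [sub_add_cancel] at h4
      have h5 := hγ q hq hq2
      linarith
    obtain ⟨p, hp, hd⟩ := h2 qk hqk hlt
    refine ⟨p, hp, ?_⟩
    calc dist (q - w) p ≤ dist (q - w) (qk - wk) + dist (qk - wk) p := dist_triangle _ _ _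
      _ ≤ (dist q qk + dist w wk) + ςs k := add_le_add (dist_sub_sub_le _ _ _ _) hd
      _ ≤ ς := by rw [dist_comm q qk, dist_comm w wk]; linarith

/-- PATCHES TRANSPORT ALONG A FINE LOCAL MATCH: if `X` and `Y` are two-way `min(η/2, 1)`-matched on
`‖·‖ ≤ R + 2` and the `(R + 1)`-patch of `Y` at `0` is `min(η/2, 1)`-good, then the `R`-patch of `X` at `0`
is `η`-good (same layered data; triangle inequality). [folklore] -/
theorem rc_patch_transfer : ∀ R η : ℝ, 0 < η → ∀ X Y : Set E3,
    BallMatch (min (η / 2) 1) (R + 2) 0 X Y →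
    (∃ a : ℝ, 47 / 50 ≤ a ∧ a ≤ 1 ∧
      ∃ (A : E3 →ₗᵢ[ℝ] E3) (s : ℤ → ℤ) (z : ℤ → ℝ), IsHaggSeq s ∧
        (∀ m : ℤ, 39 / 50 * a ≤ z (m + 1) - z m ∧ z (m + 1) - z m ≤ 17 / 20 * a) ∧
        let S : Set E3 := {p | ∃ m i j : ℤ, p = A (((i : ℝ) • triangularVec₁ a) +
          ((j : ℝ) • triangularVec₂ a) + ((haggLabel s m : ℝ) • barlowOffset a) +
          (z m • layerNormal 1))}
        (∀ p ∈ S, ‖p‖ ≤ R + 1 → ∃ q ∈ Y, dist (q - 0) p ≤ min (η / 2) 1) ∧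
        (∀ q ∈ Y, ‖q - 0‖ ≤ R + 1 → ∃ p ∈ S, dist (q - 0) p ≤ min (η / 2) 1)) →
    (∃ a : ℝ, 47 / 50 ≤ a ∧ a ≤ 1 ∧
      ∃ (A : E3 →ₗᵢ[ℝ] E3) (s : ℤ → ℤ) (z : ℤ → ℝ), IsHaggSeq s ∧
        (∀ m : ℤ, 39 / 50 * a ≤ z (m + 1) - z m ∧ z (m + 1) - z m ≤ 17 / 20 * a) ∧
        let S : Set E3 := {p | ∃ m i j : ℤ, p = A (((i : ℝ) • triangularVec₁ a) +
          ((j : ℝ) • triangularVec₂ a) + ((haggLabel s m : ℝ) • barlowOffset a) +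
          (z m • layerNormal 1))}
        (∀ p ∈ S, ‖p‖ ≤ R → ∃ q ∈ X, dist (q - 0) p ≤ η) ∧
        (∀ q ∈ X, ‖q - 0‖ ≤ R → ∃ p ∈ S, dist (q - 0) p ≤ η)) := by
  intro R η hη X Y hBM h
  obtain ⟨a, ha, ha1, A, s, z, hs, hz, h12⟩ := h
  dsimp only at h12
  obtain ⟨h1, h2⟩ := h12
  have hε2 : min (η / 2) 1 ≤ η / 2 := min_le_left _ _
  have hε1 : min (η / 2) 1 ≤ 1 := min_le_right _ _
  refine ⟨a, ha, ha1, A, s, z, hs, hz, ?_⟩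
  dsimp only
  refine ⟨fun p hp hpR => ?_, fun q hq hqR => ?_⟩
  · obtain ⟨q, hq, hd⟩ := h1 p hp (by linarith)
    rw [sub_zero] at hd
    have hqn : dist q 0 ≤ R + 2 := by
      have h3 := dist_triangle q p 0
      rw [dist_zero_right p] at h3
      linarith
    obtain ⟨x, hx, hxq⟩ := hBM.1 q hq hqn
    refine ⟨x, hx, ?_⟩
    rw [sub_zero]
    calc dist x p ≤ dist x q + dist q p := dist_triangle _ _ _
      _ ≤ η := by linarith
  · rw [sub_zero] at hqR
    obtain ⟨w, hw, hqw⟩ := hBM.2 q hq (by rw [dist_zero_right]; linarith)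
    have hwn : ‖w - 0‖ ≤ R + 1 := by
      rw [sub_zero]
      have h3 := dist_triangle w q 0
      rw [dist_zero_right, dist_zero_right, dist_comm] at h3
      linarith
    obtain ⟨p, hp, hd⟩ := h2 w hw hwn
    rw [sub_zero] at hd
    refine ⟨p, hp, ?_⟩
    rw [sub_zero]
    calc dist q p ≤ dist q w + dist w p := dist_triangle _ _ _
      _ ≤ η := by linarith

end Summit.AtomisticToContinuum.Crystallization.Theorems.DisclinationRationBarlowLiouville

end
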